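import Summits.CriticalPhenomena.PercolationContinuityZ3.Theorems.PercNearOneGluingNoHeavyLowerTailCILInduction
import Summits.CriticalPhenomena.PercolationContinuityZ3.Theorems.PercNearOneGluingNoHeavyLowerTailCILOwnEdgeStability
import HarnessLib

/-!
# `NoHeavyLowerTail` (stmt-CriticalPhenomena-4575) — the induction on positive pairs with the champion-shift condition
# required only for NON-ADJACENT champions

Support file (prover `prim-gen-induct`; `--supports stmt-CriticalPhenomena-4575`).  No definitions, no named facts, no sorries.

Notation as in `…CILInduction`: `μ_w = prodBernoulli w` on `Fin n`, relays `A`, level `j`, `I_w(x) = μ_w{|π(x)| ≤ j}`,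
champion = relay maximising `I_w`, `CS_w(S, c)` = set-champion stability, `J_w(S, x)` = lightness of `x` with `S` glued.

By OWN-EDGE STABILITY (`CutObserver.champion_of_erase_own_edge`, file `…CILOwnEdgeStability`): if the champion `c` is
joined to a vertex `v ∈ S` by a pair `e = s(c,v)` of weight `< 1`, then `c` is still a champion after switching `e` off,
so the champion-shift condition (ML) of `…CILInduction` holds there with `F = {e}`, `c_F = c` (and for a LIGHT `S` the
weight of `e` is automatically `< 1`: at weight `1` the glued vertices `c`, `v` are equally light).  Hence the hypothesis
(ML) of `setCS_of_ML` / `noHeavyLowerTail_of_ML` is needed only for champions with NO positive pair to `S`: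

THE NON-ADJACENT CHAMPION-SHIFT CONDITION (ML-na) (hypothesis `hML` below): for every weighted graph, every set `S` of
at least two non-relays, all LIGHTER than a champion `c` that has no positive pair to `S`, and `S` joined to the rest by
a positive pair, there are a nonempty set `F` of positive pairs at `S` and a champion `c_F` of `w^F` (`F` switched off)
with `J_w(S, c_F) ≤ J_w(S, c)`.  (Free sub-cases, for whoever discharges it: if `c` is a champion of `w` with ALL pairs
at `S` switched off take that `F` and `c_F = c`; if `c` maximises `J_w(S, ·)` take any `F` and any champion of `w^F`.)

* `setCS_of_MLna` — (ML-na) ⇒ `CS_w(S, c)` for every `w`, every set `S` of non-relays, every champion `c`;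
* `cumulativeIsolation_of_MLna`, `noHeavyLowerTail_of_MLna` — hence the registered stub `stub_cumulativeIsolation` and
  the crux `NoHeavyLowerTail`.
-/

noncomputable section

namespace Summit.CriticalPhenomena.PercolationContinuityZ3.Theorems

open MeasureTheory Set Literature.Probability.LatticeModels Literature.Probability.Percolation
open scoped Classical BigOperators

variable {n : ℕ}

open ChampionStability in
open CutObserver in
/-- **(ML-na) ⇒ set-champion stability (induction on the number of positive pairs).**  Assume the non-adjacent
champion-shift condition `hML` (see the file header).  Then for every weight function `w` on `Fin n`, every finite set `S` of non-relays and every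
champion `c` (`c ∈ A`, `I_w(a) ≤ I_w(c)` for `a ∈ A`): `μ_w(c ↮ S, 1 ≤ |π(S)| ≤ j) ≤ μ_w(c ↮ S, |π(c)| ≤ j)`.
The statement is proved for all `w` whose number of positive pairs is at most `m`, by induction on `m`. [folklore] -/
theorem setCS_of_MLna (A : Finset (Fin n)) (j : ℕ)
    (hML : ∀ (w : Sym2 (Fin n) → unitInterval) (S : Finset (Fin n)) (c : Fin n),
      Disjoint S A → 2 ≤ S.card → c ∈ A →
      (∀ a ∈ A, (prodBernoulli w).real {ω : BondConfig (Fin n) | (A.filter fun z => ω ∈ openConn a z).card ≤ j} ≤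
        (prodBernoulli w).real {ω : BondConfig (Fin n) | (A.filter fun z => ω ∈ openConn c z).card ≤ j}) →
      (∀ v ∈ S, (prodBernoulli w).real {ω : BondConfig (Fin n) | (A.filter fun z => ω ∈ openConn c z).card ≤ j} <
        (prodBernoulli w).real {ω : BondConfig (Fin n) | (A.filter fun z => ω ∈ openConn v z).card ≤ j}) →
      (∃ v ∈ S, ∃ y, y ∉ S ∧ w s(v, y) ≠ 0) →
      (∀ v ∈ S, w s(c, v) = 0) →
      ∃ F : Finset (Sym2 (Fin n)), F.Nonempty ∧ (∀ e ∈ F, w e ≠ 0 ∧ ∃ v ∈ S, ∃ y, y ≠ v ∧ e = s(v, y)) ∧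
        ∃ cF ∈ A,
          (∀ a ∈ A,
            (prodBernoulli (fun e => if e ∈ F then 0 else w e)).real
                {ω : BondConfig (Fin n) | (A.filter fun z => ω ∈ openConn a z).card ≤ j} ≤
              (prodBernoulli (fun e => if e ∈ F then 0 else w e)).real
                {ω : BondConfig (Fin n) | (A.filter fun z => ω ∈ openConn cF z).card ≤ j}) ∧
          (prodBernoulli w).real {ω : BondConfig (Fin n) | (∀ y ∈ S, ω ∉ openConn cF y) ∧
                (A.filter fun z => ω ∈ openConn cF z).card ≤ j} +
              (prodBernoulli w).real {ω : BondConfig (Fin n) | (∃ y ∈ S, ω ∈ openConn cF y) ∧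
                (A.filter fun z => ∃ y ∈ S, ω ∈ openConn y z).card ≤ j} ≤
            (prodBernoulli w).real {ω : BondConfig (Fin n) | (∀ y ∈ S, ω ∉ openConn c y) ∧
                (A.filter fun z => ω ∈ openConn c z).card ≤ j} +
              (prodBernoulli w).real {ω : BondConfig (Fin n) | (∃ y ∈ S, ω ∈ openConn c y) ∧
                (A.filter fun z => ∃ y ∈ S, ω ∈ openConn y z).card ≤ j})
    (m : ℕ) :
    ∀ (w : Sym2 (Fin n) → unitInterval), (Finset.univ.filter fun e => w e ≠ 0).card ≤ m →
      ∀ (S : Finset (Fin n)) (c : Fin n), Disjoint S A → S.Nonempty → c ∈ A →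
      (∀ a ∈ A, (prodBernoulli w).real {ω : BondConfig (Fin n) | (A.filter fun z => ω ∈ openConn a z).card ≤ j} ≤
        (prodBernoulli w).real {ω : BondConfig (Fin n) | (A.filter fun z => ω ∈ openConn c z).card ≤ j}) →
      (prodBernoulli w).real {ω : BondConfig (Fin n) | (∀ x ∈ S, ω ∉ openConn c x) ∧
          1 ≤ (A.filter fun z => ∃ x ∈ S, ω ∈ openConn x z).card ∧
          (A.filter fun z => ∃ x ∈ S, ω ∈ openConn x z).card ≤ j} ≤
        (prodBernoulli w).real {ω : BondConfig (Fin n) | (∀ x ∈ S, ω ∉ openConn c x) ∧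
          (A.filter fun z => ω ∈ openConn c z).card ≤ j} := by
  induction m with
  | zero =>
    intro w hcard S c hSA _ _ _
    -- no positive pair at all
    have hw0 : ∀ e, w e = 0 := by
      intro e
      by_contra hne
      have : e ∈ Finset.univ.filter fun e => w e ≠ 0 := Finset.mem_filter.2 ⟨Finset.mem_univ _, hne⟩
      rw [Finset.card_eq_zero.1 (Nat.le_zero.1 hcard)] at this
      exact absurd this (Finset.notMem_empty _)
    exact setCS_of_isolated w A S c j hSA fun v _ y _ => hw0 _
  | succ m ih =>
    intro w hcard S c hSA hSne hcA hchamp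
    -- (i) a member of `S` no lighter than `c`: lonely-cluster exchange
    by_cases hheavy : ∃ y ∈ S,
        (prodBernoulli w).real {ω : BondConfig (Fin n) | (A.filter fun z => ω ∈ openConn y z).card ≤ j} ≤
          (prodBernoulli w).real {ω : BondConfig (Fin n) | (A.filter fun z => ω ∈ openConn c z).card ≤ j}
    · obtain ⟨y, hyS, hy⟩ := hheavy
      convert observerSet_le_of_lonelier w A S y c hyS j hy using 12
    push Not at hheavy
    -- (ii) no positive pair leaving `S`
    by_cases hiso : ∀ v ∈ S, ∀ y, y ∉ S → w s(v, y) = 0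
    · exact setCS_of_isolated w A S c j hSA hiso
    push Not at hiso
    obtain ⟨v₀, hv₀S, y₀, hy₀S, hwy₀⟩ := hiso
    -- (iii) light `S` with a positive pair leaving it: get `F` and the shifted witness `cF`
    have key : ∃ F : Finset (Sym2 (Fin n)), F.Nonempty ∧ (∀ e ∈ F, w e ≠ 0 ∧ ∃ v ∈ S, ∃ y, y ≠ v ∧ e = s(v, y)) ∧
        ∃ cF ∈ A,
          (∀ a ∈ A,
            (prodBernoulli (fun e => if e ∈ F then 0 else w e)).real
                {ω : BondConfig (Fin n) | (A.filter fun z => ω ∈ openConn a z).card ≤ j} ≤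
              (prodBernoulli (fun e => if e ∈ F then 0 else w e)).real
                {ω : BondConfig (Fin n) | (A.filter fun z => ω ∈ openConn cF z).card ≤ j}) ∧
          (prodBernoulli w).real {ω : BondConfig (Fin n) | (∀ y ∈ S, ω ∉ openConn cF y) ∧
                (A.filter fun z => ω ∈ openConn cF z).card ≤ j} +
              (prodBernoulli w).real {ω : BondConfig (Fin n) | (∃ y ∈ S, ω ∈ openConn cF y) ∧
                (A.filter fun z => ∃ y ∈ S, ω ∈ openConn y z).card ≤ j} ≤
            (prodBernoulli w).real {ω : BondConfig (Fin n) | (∀ y ∈ S, ω ∉ openConn c y) ∧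
                (A.filter fun z => ω ∈ openConn c z).card ≤ j} +
              (prodBernoulli w).real {ω : BondConfig (Fin n) | (∃ y ∈ S, ω ∈ openConn c y) ∧
                (A.filter fun z => ∃ y ∈ S, ω ∈ openConn y z).card ≤ j} := by
      by_cases h2 : 2 ≤ S.card
      · by_cases hadj : ∃ v ∈ S, w s(c, v) ≠ 0
        · -- ADJACENT champion: own-edge stability (`champion_of_erase_own_edge`), `F = {s(v,c)}`, `cF = c`
          obtain ⟨v, hvS, hwv⟩ := hadj
          have hcv : c ≠ v := fun h => Finset.disjoint_left.1 hSA hvS (h ▸ hcA)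
          set Rc := {ω : BondConfig (Fin n) | (A.filter fun z => ω ∈ openConn c z).card ≤ j} with hRc
          set Rv := {ω : BondConfig (Fin n) | (A.filter fun z => ω ∈ openConn v z).card ≤ j} with hRv
          -- the pair `s(c,v)` has weight `< 1`: otherwise `c` and `v` are glued and equally light
          have hw1 : (w s(c, v) : ℝ) < 1 := by
            by_contra hge
            push Not at hge
            have heq1 : (w s(c, v) : ℝ) = 1 := le_antisymm (w s(c, v)).2.2 hge
            have hadjcv : ∀ ω : BondConfig (Fin n), (openGraph (insert s(c, v) ω)).Reachable c v := by
              intro ω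
              have h' : (openGraph (insert s(c, v) ω)).Adj c v := by
                rw [openGraph_adj]; exact ⟨Set.mem_insert _ _, hcv⟩
              exact h'.reachable
            have hpre : (fun ω : BondConfig (Fin n) => insert s(c, v) ω) ⁻¹' Rc =
                (fun ω : BondConfig (Fin n) => insert s(c, v) ω) ⁻¹' Rv := by
              ext ω
              simp only [mem_preimage, hRc, hRv, mem_setOf_eq]
              have heq : (A.filter fun z => insert s(c, v) ω ∈ openConn c z) =
                  (A.filter fun z => insert s(c, v) ω ∈ openConn v z) :=
                Finset.filter_congr fun z _ =>
                  ⟨fun h => (hadjcv ω).symm.trans h, fun h => (hadjcv ω).trans h⟩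
              rw [heq]
            set w₀ := Function.update w s(c, v) 0 with hw₀
            have hw₀e : w₀ s(c, v) = 0 := by simp [hw₀]
            have hw₁ : Function.update w s(c, v) 1 = Function.update w₀ s(c, v) 1 := by
              rw [hw₀, Function.update_idem]
            have h1 : (prodBernoulli w).real Rc =
                (prodBernoulli w₀).real ((fun ω : BondConfig (Fin n) => insert s(c, v) ω) ⁻¹' Rc) := by
              rw [stub_oneBondDecomp_k15 n w s(c, v) Rc, heq1, hw₁, real_update_one_eq w₀ hw₀e]; ring
            have h2' : (prodBernoulli w).real Rv =
                (prodBernoulli w₀).real ((fun ω : BondConfig (Fin n) => insert s(c, v) ω) ⁻¹' Rv) := by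
              rw [stub_oneBondDecomp_k15 n w s(c, v) Rv, heq1, hw₁, real_update_one_eq w₀ hw₀e]; ring
            have hlt := hheavy v hvS
            rw [h1, h2', hpre] at hlt
            exact lt_irrefl _ hlt
          refine ⟨{s(v, c)}, Finset.singleton_nonempty _, ?_, c, hcA, ?_, le_refl _⟩
          · intro e he
            rw [Finset.mem_singleton] at he
            subst he
            refine ⟨?_, v, hvS, c, hcv, rfl⟩
            rw [Sym2.eq_swap]; exact hwv
          · have hfun : (fun e => if e ∈ ({s(v, c)} : Finset (Sym2 (Fin n))) then (0 : unitInterval) else w e) =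
                Function.update w s(c, v) 0 := by
              funext e
              have hvc : s(v, c) = s(c, v) := Sym2.eq_swap
              simp only [Finset.mem_singleton, Function.update_apply, hvc]
            rw [hfun]
            exact champion_of_erase_own_edge w A c v j hcv hw1 hchamp
        · push Not at hadj
          exact hML w S c hSA h2 hcA hchamp hheavy ⟨v₀, hv₀S, y₀, hy₀S, hwy₀⟩ hadj
      · -- `S = {v₀}`: switch off ALL positive pairs at `v₀`, take any champion of the result
        have hS1 : S = {v₀} := by
          have hc1 : S.card = 1 := by
            have := Finset.card_pos.2 hSne; omega
          obtain ⟨x, hx⟩ := Finset.card_eq_one.1 hc1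
          rw [hx] at hv₀S; rw [Finset.mem_singleton.1 hv₀S]; exact hx
        set F : Finset (Sym2 (Fin n)) :=
          Finset.univ.filter fun e => w e ≠ 0 ∧ ∃ y, y ≠ v₀ ∧ e = s(v₀, y) with hF
        have hy₀v₀ : y₀ ≠ v₀ := fun h => hy₀S (h ▸ hv₀S)
        have hFne : F.Nonempty :=
          ⟨s(v₀, y₀), Finset.mem_filter.2 ⟨Finset.mem_univ _, hwy₀, y₀, hy₀v₀, rfl⟩⟩
        have hFmem : ∀ e ∈ F, w e ≠ 0 ∧ ∃ v ∈ S, ∃ y, y ≠ v ∧ e = s(v, y) := by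
          intro e he
          obtain ⟨-, hwe, y, hy, rfl⟩ := Finset.mem_filter.1 he
          exact ⟨hwe, v₀, hv₀S, y, hy, rfl⟩
        have hAne : A.Nonempty := ⟨c, hcA⟩
        obtain ⟨cF, hcFA, hcFmax⟩ := Finset.exists_max_image A
          (fun a => (prodBernoulli (fun e => if e ∈ F then 0 else w e)).real
            {ω : BondConfig (Fin n) | (A.filter fun z => ω ∈ openConn a z).card ≤ j}) hAne
        refine ⟨F, hFne, hFmem, cF, hcFA, hcFmax, ?_⟩
        rw [hS1, glued_singleton, glued_singleton]
        exact hchamp cF hcFA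
    obtain ⟨F, hFne, hFmem, cF, hcFA, hcFchamp, hshift⟩ := key
    -- the graph with `F` switched off has fewer positive pairs
    set wF : Sym2 (Fin n) → unitInterval := fun e => if e ∈ F then 0 else w e with hwF
    have hsub : (Finset.univ.filter fun e => wF e ≠ 0) ⊆ (Finset.univ.filter fun e => w e ≠ 0) \ F := by
      intro e he
      rw [Finset.mem_filter] at he
      rw [Finset.mem_sdiff, Finset.mem_filter]
      by_cases heF : e ∈ F
      · simp [hwF, heF] at he
      · simp only [hwF, heF, if_false] at he
        exact ⟨⟨Finset.mem_univ _, he.2⟩, heF⟩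
    have hFsub : F ⊆ Finset.univ.filter fun e => w e ≠ 0 :=
      fun e he => Finset.mem_filter.2 ⟨Finset.mem_univ _, (hFmem e he).1⟩
    have hcardF : (Finset.univ.filter fun e => wF e ≠ 0).card ≤ m := by
      have h1 := Finset.card_le_card hsub
      rw [Finset.card_sdiff_of_subset hFsub] at h1
      have h2 := Finset.card_pos.2 hFne
      omega
    -- `CS_w(S, cF)` by edge raising from `wF`
    have hcFS : cF ∉ S := fun h => Finset.disjoint_left.1 hSA h hcFA
    have hFshape : ∀ e ∈ F, ∃ v ∈ S, ∃ y, y ≠ v ∧ e = s(v, y) := fun e he => (hFmem e he).2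
    have hbase : ∀ T : Finset (Fin n), S ⊆ T → cF ∉ T →
        (prodBernoulli wF).real {ω : BondConfig (Fin n) |
            (∀ x ∈ T, ω ∉ openConn cF x) ∧ 1 ≤ (A.filter fun z => ∃ x ∈ T, ω ∈ openConn x z).card ∧
            (A.filter fun z => ∃ x ∈ T, ω ∈ openConn x z).card ≤ j} ≤
          (prodBernoulli wF).real {ω : BondConfig (Fin n) |
            (∀ x ∈ T, ω ∉ openConn cF x) ∧ (A.filter fun z => ω ∈ openConn cF z).card ≤ j} := by
      intro T hST hcFT
      by_cases hTA : Disjoint T A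
      · exact ih wF hcardF T cF hTA (hSne.mono hST) hcFA hcFchamp
      · -- `T` contains a relay `a`: lonely-cluster exchange with `a` (no lighter than the champion `cF` of `wF`)
        rw [Finset.not_disjoint_iff] at hTA
        obtain ⟨a, haT, haA⟩ := hTA
        convert observerSet_le_of_lonelier wF A T a cF haT j (hcFchamp a haA) using 12
    have hCSF := setCS_of_subgraph A S cF j hcFS F hFshape w hbase S (Finset.Subset.refl _) hcFS
    -- shift the witness from `cF` to `c`
    rw [bad_le_glued_iff_setCS w A S c j hcA]
    rw [bad_le_glued_iff_setCS w A S cF j hcFA] at hCSF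
    exact hCSF.trans hshift

open CutObserver in
/-- **(ML-na) ⇒ the cumulative isolation lemma** (`stub_cumulativeIsolation` of the crux `NoHeavyLowerTail`,
stmt-CriticalPhenomena-4575): for every weighted graph, every nonempty relay set `A`, every observer `o ∉ A` and every level
`j`, some relay `a` has `μ{1 ≤ N ≤ j} ≤ μ{|π(a)| ≤ j}` — namely any champion, by `setCS_of_MLna` at `S = {o}` and
`cil_of_setCS_singleton`. [folklore] -/
theorem cumulativeIsolation_of_MLna
    (hML : ∀ (n : ℕ) (w : Sym2 (Fin n) → unitInterval) (A S : Finset (Fin n)) (c : Fin n) (j : ℕ),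
      Disjoint S A → 2 ≤ S.card → c ∈ A →
      (∀ a ∈ A, (prodBernoulli w).real {ω : BondConfig (Fin n) | (A.filter fun z => ω ∈ openConn a z).card ≤ j} ≤
        (prodBernoulli w).real {ω : BondConfig (Fin n) | (A.filter fun z => ω ∈ openConn c z).card ≤ j}) →
      (∀ v ∈ S, (prodBernoulli w).real {ω : BondConfig (Fin n) | (A.filter fun z => ω ∈ openConn c z).card ≤ j} <
        (prodBernoulli w).real {ω : BondConfig (Fin n) | (A.filter fun z => ω ∈ openConn v z).card ≤ j}) →
      (∃ v ∈ S, ∃ y, y ∉ S ∧ w s(v, y) ≠ 0) →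
      (∀ v ∈ S, w s(c, v) = 0) →
      ∃ F : Finset (Sym2 (Fin n)), F.Nonempty ∧ (∀ e ∈ F, w e ≠ 0 ∧ ∃ v ∈ S, ∃ y, y ≠ v ∧ e = s(v, y)) ∧
        ∃ cF ∈ A,
          (∀ a ∈ A,
            (prodBernoulli (fun e => if e ∈ F then 0 else w e)).real
                {ω : BondConfig (Fin n) | (A.filter fun z => ω ∈ openConn a z).card ≤ j} ≤
              (prodBernoulli (fun e => if e ∈ F then 0 else w e)).real
                {ω : BondConfig (Fin n) | (A.filter fun z => ω ∈ openConn cF z).card ≤ j}) ∧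
          (prodBernoulli w).real {ω : BondConfig (Fin n) | (∀ y ∈ S, ω ∉ openConn cF y) ∧
                (A.filter fun z => ω ∈ openConn cF z).card ≤ j} +
              (prodBernoulli w).real {ω : BondConfig (Fin n) | (∃ y ∈ S, ω ∈ openConn cF y) ∧
                (A.filter fun z => ∃ y ∈ S, ω ∈ openConn y z).card ≤ j} ≤
            (prodBernoulli w).real {ω : BondConfig (Fin n) | (∀ y ∈ S, ω ∉ openConn c y) ∧
                (A.filter fun z => ω ∈ openConn c z).card ≤ j} +
              (prodBernoulli w).real {ω : BondConfig (Fin n) | (∃ y ∈ S, ω ∈ openConn c y) ∧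
                (A.filter fun z => ∃ y ∈ S, ω ∈ openConn y z).card ≤ j})
    (n : ℕ) (w : Sym2 (Fin n) → unitInterval) (A : Finset (Fin n)) (o : Fin n) (j : ℕ)
    (hA : A.Nonempty) (hoA : o ∉ A) :
    ∃ a ∈ A,
      (prodBernoulli w).real {ω : BondConfig (Fin n) |
          1 ≤ (A.filter fun x => ω ∈ openConn o x).card ∧ (A.filter fun x => ω ∈ openConn o x).card ≤ j} ≤
        (prodBernoulli w).real {ω : BondConfig (Fin n) | (A.filter fun x => ω ∈ openConn a x).card ≤ j} := by
  obtain ⟨c, hcA, hcmax⟩ := Finset.exists_max_image A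
    (fun a => (prodBernoulli w).real {ω : BondConfig (Fin n) | (A.filter fun z => ω ∈ openConn a z).card ≤ j}) hA
  refine ⟨c, hcA, cil_of_setCS_singleton w A o c j ?_⟩
  have hSA : Disjoint ({o} : Finset (Fin n)) A := by
    rw [Finset.disjoint_singleton_left]; exact hoA
  exact setCS_of_MLna A j (fun w' S' c' => hML n w' A S' c' j) _ w le_rfl {o} c hSA (Finset.singleton_nonempty o)
    hcA hcmax

/-- **(ML-na) closes the crux**: the non-adjacent champion-shift condition implies `NoHeavyLowerTail`, through
`cumulativeIsolation_of_MLna` and the landed `noHeavyLowerTail_of_stub_cumulativeIsolation`. -/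
theorem noHeavyLowerTail_of_MLna
    (hML : ∀ (n : ℕ) (w : Sym2 (Fin n) → unitInterval) (A S : Finset (Fin n)) (c : Fin n) (j : ℕ),
      Disjoint S A → 2 ≤ S.card → c ∈ A →
      (∀ a ∈ A, (prodBernoulli w).real {ω : BondConfig (Fin n) | (A.filter fun z => ω ∈ openConn a z).card ≤ j} ≤
        (prodBernoulli w).real {ω : BondConfig (Fin n) | (A.filter fun z => ω ∈ openConn c z).card ≤ j}) →
      (∀ v ∈ S, (prodBernoulli w).real {ω : BondConfig (Fin n) | (A.filter fun z => ω ∈ openConn c z).card ≤ j} <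
        (prodBernoulli w).real {ω : BondConfig (Fin n) | (A.filter fun z => ω ∈ openConn v z).card ≤ j}) →
      (∃ v ∈ S, ∃ y, y ∉ S ∧ w s(v, y) ≠ 0) →
      (∀ v ∈ S, w s(c, v) = 0) →
      ∃ F : Finset (Sym2 (Fin n)), F.Nonempty ∧ (∀ e ∈ F, w e ≠ 0 ∧ ∃ v ∈ S, ∃ y, y ≠ v ∧ e = s(v, y)) ∧
        ∃ cF ∈ A,
          (∀ a ∈ A,
            (prodBernoulli (fun e => if e ∈ F then 0 else w e)).real
                {ω : BondConfig (Fin n) | (A.filter fun z => ω ∈ openConn a z).card ≤ j} ≤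
              (prodBernoulli (fun e => if e ∈ F then 0 else w e)).real
                {ω : BondConfig (Fin n) | (A.filter fun z => ω ∈ openConn cF z).card ≤ j}) ∧
          (prodBernoulli w).real {ω : BondConfig (Fin n) | (∀ y ∈ S, ω ∉ openConn cF y) ∧
                (A.filter fun z => ω ∈ openConn cF z).card ≤ j} +
              (prodBernoulli w).real {ω : BondConfig (Fin n) | (∃ y ∈ S, ω ∈ openConn cF y) ∧
                (A.filter fun z => ∃ y ∈ S, ω ∈ openConn y z).card ≤ j} ≤
            (prodBernoulli w).real {ω : BondConfig (Fin n) | (∀ y ∈ S, ω ∉ openConn c y) ∧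
                (A.filter fun z => ω ∈ openConn c z).card ≤ j} +
              (prodBernoulli w).real {ω : BondConfig (Fin n) | (∃ y ∈ S, ω ∈ openConn c y) ∧
                (A.filter fun z => ∃ y ∈ S, ω ∈ openConn y z).card ≤ j}) :
    Summit.CriticalPhenomena.PercolationContinuityZ3.Theses.PercNearOneGluing.NoHeavyLowerTail :=
  noHeavyLowerTail_of_stub_cumulativeIsolation fun n w A o j hA hoA =>
    cumulativeIsolation_of_MLna hML n w A o j hA hoA

end Summit.CriticalPhenomena.PercolationContinuityZ3.Theorems

end
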